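import Mathlib.NumberTheory.DirichletCharacter.Basic
import Mathlib.Data.Complex.Basic
import Mathlib.Data.Set.Finite.Basic
import Mathlib.Data.Nat.Prime.Defs
import HarnessLib

/-!
# Completely multiplicative automatic sequences are essentially Dirichlet characters (Klurman–Kurlberg 2019)

Trunk T-ANT (`Literature/NumberTheory/LFunctions`), problem `PneNP`, route `Mobius` (D-0016): the
rigidity crux `Summit.PneNP.PneNP.Theses.Mobius.AC0MultiplicativePretentious`
(item `stmt-PneNP-1108`: a completely multiplicative `f : ℕ →* ℤ` with `f(p) = ±1` whose language
`{bin(n) : f(n) = 1}` lies in `AC⁰` is not non-pretentious) is announced by the planner as the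
lift "from automata to `AC⁰`" of the classification of completely multiplicative AUTOMATIC
sequences. That classification — "rung 0" of the rigidity line, the nearest statement in print —
is vendored here verbatim as the named fact `KlurmanKurlberg2019_thm13`, together with the
printed (q-kernel) definition of `q`-automaticity it is stated over (`qKernel`, `IsAutomaticSeq`).
The same fact is the classification input named by route `QuantumAdvantage/MobiusLadder`
(regularity / automaticity side rung).

The item `Mobius.AC0MultiplicativePretentious` is NOT an instance of this fact: `2`-automatic
(= the fibres `{bin(n) : f n = a}` are regular languages) and `AC⁰` are incomparable classes
(PARITY-type automatic sequences are not in `AC⁰`; `AC⁰` languages need not be regular), so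
neither statement implies the other; the fact is recorded as nearest prior art and as a usable
hypothesis for the automatic sub-case.

## Rendering choices

* `q`-automatic is Definition 1.1 of the paper (finiteness of the `q`-kernel
  `K_q(f) = { (f(qⁱn + r))_{n ≥ 0} : i ≥ 1, 0 ≤ r ≤ qⁱ − 1 }`), which is Allouche–Shallit's
  kernel characterisation (Automatic Sequences, Thm 6.6.2); no automaton vocabulary is needed.
* "completely multiplicative, `f(mn) = f(m) f(n)` for all `m, n ∈ ℕ`" is imposed for ALL naturals
  including `0` (Lean's `ℕ`); this is at least as strong a hypothesis as the printed one, so the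
  fact is at most as strong as the printed theorem.
* "a Dirichlet character of conductor `Q` such that `f(n) = χ(n)` for all `(n, Q) = 1`" is rendered
  as `∃ Q > 0, ∃ χ : DirichletCharacter ℂ Q, ∀ n coprime to Q, f n = χ n` (a character of
  conductor `Q` is in particular a character of modulus `Q`; again at most as strong as print).
* "`f(p) = 0` for all sufficiently large `p`" is `∃ P₀, ∀ p prime, P₀ ≤ p → f p = 0`.

## References

* O. Klurman, P. Kurlberg, *A note on multiplicative automatic sequences*, C. R. Math. Acad. Sci.
  Paris 357 (2019) 752–755 = arXiv:1904.04337; Definition 1.1 and Theorem 1.3 (arXiv numbering),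
  read from the held text `paper:arxiv-1904.04337` (chunk 3: "Let q ≥ 2 and let f : ℕ → ℂ be
  completely multiplicative q-automatic sequence. Then, there exists a Dirichlet character of
  conductor Q such that either f(n) = χ(n), for all (n, Q) = 1 or f(p) = 0 for all sufficiently
  large p."). [KlurmanKurlberg2019]
* J. Konieczny, M. Lemańczyk, C. Müllner, *Multiplicative automatic sequences* (the general,
  not necessarily completely multiplicative, classification). [KoniecznyLemanczykMullner2021]
-/

namespace Literature.NumberTheory.LFunctions

/-- The `q`-kernel of a sequence `f : ℕ → ℂ` (Klurman–Kurlberg 2019, Definition 1.1):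
`K_q(f) = { (f(qⁱ·n + r))_{n ≥ 0} : i ≥ 1, 0 ≤ r ≤ qⁱ − 1 }`, the set of subsequences along the
residue classes modulo powers of `q`. [cite: KlurmanKurlberg2019, Def 1.1] -/
def qKernel (q : ℕ) (f : ℕ → ℂ) : Set (ℕ → ℂ) :=
  {g | ∃ i : ℕ, 1 ≤ i ∧ ∃ r : ℕ, r < q ^ i ∧ g = fun n => f (q ^ i * n + r)}

/-- A sequence `f : ℕ → ℂ` is `q`-AUTOMATIC if its `q`-kernel is finite (Klurman–Kurlberg 2019,
Definition 1.1: "The sequence `f : ℕ → ℂ` is called `q`-automatic if the `q`-kernel of it … is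
finite"; this is the kernel characterisation of automatic sequences, Allouche–Shallit Thm 6.6.2,
equivalent to generation by a finite automaton reading base-`q` digits). Such an `f` takes only
finitely many values. [cite: KlurmanKurlberg2019, Def 1.1] -/
def IsAutomaticSeq (q : ℕ) (f : ℕ → ℂ) : Prop :=
  (qKernel q f).Finite

/-- **Klurman–Kurlberg 2019, Theorem 1.3** (completely multiplicative automatic sequences are
essentially Dirichlet characters; confirms the Bell–Bruin–Coons conjecture in the completely
multiplicative case and answers a question of Allouche–Goldmakher): "Let `q ≥ 2` and let
`f : ℕ → ℂ` be completely multiplicative `q`-automatic sequence. Then, there exists a Dirichlet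
character of conductor `Q` such that either `f(n) = χ(n)`, for all `(n, Q) = 1` or `f(p) = 0` for
all sufficiently large `p`." Rendered: for `2 ≤ q` and `f : ℕ → ℂ` with `f (m*n) = f m * f n` for
all naturals and finite `q`-kernel, there are `Q > 0` and a Dirichlet character `χ` mod `Q` with
either `f n = χ n` for every `n` coprime to `Q`, or `f p = 0` for all primes `p ≥ P₀`.
Grounds (as nearest prior art, automatic in place of `AC⁰`) the crux
`Summit.PneNP.PneNP.Theses.Mobius.AC0MultiplicativePretentious`.
[cite: KlurmanKurlberg2019, Thm 1.3 (arXiv:1904.04337 numbering)] -/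
def KlurmanKurlberg2019_thm13 : Prop :=
  ∀ q : ℕ, 2 ≤ q → ∀ f : ℕ → ℂ, (∀ m n : ℕ, f (m * n) = f m * f n) → IsAutomaticSeq q f →
    ∃ Q : ℕ, 0 < Q ∧ ∃ χ : DirichletCharacter ℂ Q,
      (∀ n : ℕ, Nat.Coprime n Q → f n = χ n) ∨
        (∃ P₀ : ℕ, ∀ p : ℕ, p.Prime → P₀ ≤ p → f p = 0)

end Literature.NumberTheory.LFunctions
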